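import Literature.MathematicalPhysics.QuantumFieldTheory.Balaban1983to89.Beta.OneStepKernelFamily

/-!
# `BalabanUV.Beta.FP.SymmetryLimit` — road «FP» for binder row D1, leaf N3-inherit: the PRINTED SYMMETRY CLASS (Ward transversality (5.9),
# axis-reflection covariance (5.7)–(5.8)) is CLOSED UNDER ENTRYWISE LIMITS of kernel families, so the limit kernel `T∞` of road A2 inherits
# `hW`/`hR` from the wall family's finite-`j` binders the moment those rows close — ZERO new analysis

HONEST FRAMING (cell contract, verbatim): «discharging `BetaPertH` makes Bałaban's UV stability UNCONDITIONAL — a real constructive-QFT result;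
it is NOT the continuum limit and NOT the Clay problem.»  THIS MODULE DISCHARGES NOTHING: it is the elementary fact that finitely many pointwise
linear identities pass to pointwise limits (`tendsto_nhds_unique`, `Tendsto.sub`, `tendsto_finsetSum`).  Skeleton
`HOME/beta/skeletons/D1-b2b-balaban-beta-d1-p3.md` leaf N3 (unit `b2b-balaban-beta-d1-p3`).  NOT BetaPertH, NOT continuum, NOT Clay.
ABSOLUTE RULE (cell, verbatim): «No internally-minted statement may enter as a cited fact. Every hypothesis is either kernel-proved in this package or a
verbatim quotation of a PUBLISHED theorem with page reference.»  `WardTransversal` / `AxisReflectionCovariant` are the cell's typed PREDICATES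
(`PolarizationSign`, [Balaban1987RG1] (5.7)–(5.9) p. 293 as hypothesis shapes); nothing is asserted of Bałaban's kernels.

CONTENT: `wardTransversal_of_tendsto`, `axisReflectionCovariant_of_tendsto` (pointwise limits of kernels in the class stay in the class),
`flipK_tendsto` (the `flipK` re-reading commutes with pointwise limits), `wardTransversal_flipK_of_tendsto` / `axisReflectionCovariant_flipK_of_tendsto`
(the form in which `OneStepKernelFamily.d1Drift_of_D1Tel_D1Rep` and road FP's N3 consume them: `∀ j, P (flipK (T j))` + `T j → T∞` entrywise ⇒ `P (flipK T∞)`).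
-/

namespace Summit.QuantumFields.BalabanUV.Beta.FP.SymmetryLimit

open Filter Topology
open Literature.MathematicalPhysics.QuantumFieldTheory.Balaban1983to89
open Literature.MathematicalPhysics.QuantumFieldTheory.Balaban1983to89.Beta
open PolarizationSign (WardTransversal AxisReflectionCovariant)
open OneStepKernelFamily (flipK)
open Literature.MathematicalPhysics.QuantumFieldTheory.Balaban1983to89.B6BondElimination (unitVec)

variable {d : ℕ}

/-- [our object] **WARD TRANSVERSALITY PASSES TO POINTWISE LIMITS**: if every `T j` is Ward-transversal and `T j μ ν z → T∞ μ ν z` for all entries,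
then `T∞` is Ward-transversal. -/
theorem wardTransversal_of_tendsto {T : ℕ → B12Beta.Kernel d} {Tinf : B12Beta.Kernel d}
    (hT : ∀ j, WardTransversal (T j)) (hlim : ∀ μ ν z, Tendsto (fun j => T j μ ν z) atTop (𝓝 (Tinf μ ν z))) :
    WardTransversal Tinf := by
  intro ν z
  have hsum : Tendsto (fun j => ∑ μ, (T j μ ν (z - unitVec μ) - T j μ ν z)) atTop
      (𝓝 (∑ μ, (Tinf μ ν (z - unitVec μ) - Tinf μ ν z))) :=
    tendsto_finsetSum _ fun μ _ => (hlim μ ν _).sub (hlim μ ν z)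
  have hzero : Tendsto (fun j => ∑ μ, (T j μ ν (z - unitVec μ) - T j μ ν z)) atTop (𝓝 0) := by
    simp only [hT _ ν z]; exact tendsto_const_nhds
  exact tendsto_nhds_unique hsum hzero

/-- [our object] **AXIS-REFLECTION COVARIANCE PASSES TO POINTWISE LIMITS**. -/
theorem axisReflectionCovariant_of_tendsto {T : ℕ → B12Beta.Kernel d} {Tinf : B12Beta.Kernel d}
    (hT : ∀ j, AxisReflectionCovariant (T j)) (hlim : ∀ μ ν z, Tendsto (fun j => T j μ ν z) atTop (𝓝 (Tinf μ ν z))) :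
    AxisReflectionCovariant Tinf := by
  intro α μ ν z
  have h1 := hlim μ ν (PolarizationSign.axisReflect α z - (if μ = α then unitVec α else 0)
    + (if ν = α then unitVec α else 0))
  have h2 : Tendsto (fun j => T j μ ν (PolarizationSign.axisReflect α z - (if μ = α then unitVec α else 0)
      + (if ν = α then unitVec α else 0))) atTop
      (𝓝 (PolarizationSign.reflSign α μ * PolarizationSign.reflSign α ν * Tinf μ ν z)) := by
    simp only [hT _ α μ ν z]
    exact (hlim μ ν z).const_mul _
  exact tendsto_nhds_unique h1 h2

/-- [our object] The `flipK` re-reading (printed difference variable, RULING (R21)) commutes with pointwise limits. -/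
theorem flipK_tendsto {D : ℕ} {T : ℕ → DressedMomentNormalisation.EKer D} {Tinf : DressedMomentNormalisation.EKer D}
    (hlim : ∀ μ ν z, Tendsto (fun j => T j μ ν z) atTop (𝓝 (Tinf μ ν z))) (μ ν : Fin D) (z : Fin D → ℤ) :
    Tendsto (fun j => flipK (T j) μ ν z) atTop (𝓝 (flipK Tinf μ ν z)) :=
  hlim μ ν (-z)

/-- [our object] **N3-inherit, Ward half**: `∀ j, WardTransversal (flipK (T j))` and `T j → T∞` entrywise ⇒ `WardTransversal (flipK T∞)`. -/
theorem wardTransversal_flipK_of_tendsto {T : ℕ → DressedMomentNormalisation.EKer d} {Tinf : DressedMomentNormalisation.EKer d}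
    (hT : ∀ j, WardTransversal (flipK (T j))) (hlim : ∀ μ ν z, Tendsto (fun j => T j μ ν z) atTop (𝓝 (Tinf μ ν z))) :
    WardTransversal (flipK Tinf) :=
  wardTransversal_of_tendsto (T := fun j => flipK (T j)) hT (flipK_tendsto hlim)

/-- [our object] **N3-inherit, reflection half**: `∀ j, AxisReflectionCovariant (flipK (T j))` and `T j → T∞` entrywise ⇒
`AxisReflectionCovariant (flipK T∞)`. -/
theorem axisReflectionCovariant_flipK_of_tendsto {T : ℕ → DressedMomentNormalisation.EKer d} {Tinf : DressedMomentNormalisation.EKer d}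
    (hT : ∀ j, AxisReflectionCovariant (flipK (T j))) (hlim : ∀ μ ν z, Tendsto (fun j => T j μ ν z) atTop (𝓝 (Tinf μ ν z))) :
    AxisReflectionCovariant (flipK Tinf) :=
  axisReflectionCovariant_of_tendsto (T := fun j => flipK (T j)) hT (flipK_tendsto hlim)

end Summit.QuantumFields.BalabanUV.Beta.FP.SymmetryLimit
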